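import Literature.MathematicalPhysics.QuantumFieldTheory.Balaban1983to89.B9Eq334LaplaceACovariance
import Literature.MathematicalPhysics.QuantumFieldTheory.Balaban1983to89.B9Eq332QprimeTowerGaugeCovariance

/-!
# `Balaban1983to89.B9Eq334LaplaceAkCovariance` — T. Bałaban, *Propagators for lattice gauge theories in a background field*, Commun. Math. Phys. **99**
# (1985) 389–434 [Balaban1985BackgroundPropagators] (3.31)–(3.34) pp. 395–396 with (3.15) p. 393, (3.21)–(3.26) pp. 394–395; [Balaban1985Averaging] (11) p. 19,
# Prop. 2 (52)–(54) p. 26: **(3.34) ONE STOREY UP — `Δ^{(k)}_a(U^u) R(u) = R(u) Δ^{(k)}_a(U)` FOR THE CHAIN's `k`-LEVEL OPERATOR `laplaceAk`** (the composite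
# averaging `Q_k(U)` of (3.15), the projection `R_k(U)` onto `Δ^η_U N(Q′_k(U))`, the Hessian (3.10)), under print's class (52) for the periodic extension
# (the level backgrounds `Ū^j` are then defined inside the logarithm's domain and `\overline{U^u}^j = (Ū^j)^{u_j}`), for a unitary-type gauge `u`

statement-level skeleton of published theorems with citation tags; proofs where landed; nothing here is a claim about the Yang–Mills mass gap

CITATION HEADER (lean-in-tree rule).  Audit cell `pub-balaban`, sub-cell `t4`, BINDER row NE9; filed by NE9 formalisation-swarm leaf prover 03
(`b2b-balaban-t4-ne9-formalise-leaf-03`, gen 65), INTENT I-ne9leaf03-g65-3 — the k-level twin of `B9Eq334LaplaceACovariance` (one step), on this lineage's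
(T2′) `B9Eq332QprimeTowerGaugeCovariance` ((3.32) one storey up).  Sources READ in the held text `paper:balaban1985-cmp99-background-propagators` (journal page
= PDF page + 388): pp. 393–396.  Objects BY NAME: the owner's `towerP`, `UlevOf`, `Qtower`, `QkOfU`, `QkW`, `QprimeTowerW`, `RofUk`, `laplaceAk`; the chain's
`gaugeU`, `gaugeW`, `AdW`, `AdA`, `hessOp`; the one-step letters `QtorusLin_gaugeU`, `hU1_gaugeU`, `hreg_gaugeU`, `covLaplaceSiteK_gaugeU`, `hessOp_gaugeU`,
`adjointQ_gaugeU`, `map_projR_of_intertwine`; nothing re-declared, 0 `def`.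

THE PRINT (verbatim, p. 395–396).  *«Let us consider gauge transformations U → U^u, U′ → R(u)U′ (3.28) … R(U^u(Γ_{y,x})) = R(u(y))R(U(Γ_{y,x}))R(u⁻¹(x)) …
(3.31) Δ^η_{U^u} R(u) = R(u) Δ^η_U, (3.32) Q′_j(U^u)R(u) = R(u)Q′_j(U) … The equalities (3.31), (3.32) imply further (3.33) G′(U^u) = R(u)G′(U)R(u⁻¹),
R(U^u) = R(u)R(U)R(u⁻¹).  Finally inspecting the definitions of the averaging operators Q_j(U) for gauge fields we can see that the equalities (3.32) hold again.
This implies the transformation laws for the operators Δ_a and G: (3.34) Δ_a(U^u) = R(u)Δ_a(U)R(u⁻¹), G(U^u) = R(u)G(U)R(u⁻¹).»*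

WHAT IS PROVED (sorry-free; proof lane — 0 `def`; [folklore] composition of landed one-step letters up the tower).  Throughout: `U : Bond(T_{L^{n+1}m}) → S`
(`S ≤ U1` averaging-closed), `C₀α₀ ≤ ⅓`, `2α₀ ≤ c₂′`, `pdev Ũ < α₀N⁻²` (`N = L^{n+1}`), a gauge `u : T_{L^{n+1}m} → S`; the LEVEL GAUGES
`u_j(x) = u(L^{n+1−j}·x̃ mod L^{n+1}m)` on `T_{L^j m}` (`u_{n+1} = u`, `u_0(y) = u(N·ỹ)` at the unit block origins), written out, no `def`.
* §1 «(3.32) hold again» FOR THE COMPOSITE `Q_{n+1}(U)` (𝔸-valued, `B9Eq315QTower.Qtower ∕ QkOfU`): **`Qtower_gaugeU`** — for `j ≤ n+1`,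
  `Q_j(\overline{U^u})(R(u_j)A) = R(u_0)(Q_j(Ū)A)` (induction on `Qtower_succ`; each factor `QtorusLin_gaugeU` at the level background `(Ū^j)^{u_{j+1}}`
  = `\overline{U^u}^j` (`UlevOf_gaugeU`), level gauges compatible (`gauge_level_compat`)); **`QkOfU_gaugeU`**; §2 **`QkW_gaugeU`** — on the weighted `L²`
  carriers: `Q_{n+1}(U^u)(R(u)f) = R(u_0)(Q_{n+1}(U)f)` — WHATEVER regularity witnesses are supplied on the two sides (E162's data enter `QkW` as arguments;
  the value does not depend on them).
* §3 **`QprimeTowerW_gaugeU_eq_zero_iff`**, **`RofUk_gaugeU`** ((3.33b) one storey up: `R_k(U^u)R(u) = R(u)R_k(U)`, `R(u)` fibrewise isometric — the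
  one-step proof `B9Eq333ProjectionCovariance.RofU_gaugeU` verbatim on the tower objects), `RofUk_gaugeU_conj`.
* §4 **`laplaceAk_gaugeU`** ((3.34a): `Δ^{(n+1)}_a(U^u)(R(u)f) = R(u)(Δ^{(n+1)}_a(U)f)`), **`laplaceAk_gaugeU_conj`** (`Δ^{(n+1)}_a(U^u) = R(u)Δ^{(n+1)}_a(U)R(u⁻¹)`),
  **`inner_laplaceAk_gaugeU`** (the form is gauge invariant), **`hposk_gaugeU_iff`** (positive definiteness transfers both ways).
* §5 E162's data transfer along the orbit at every level `j ≤ n` (`hU1k_gaugeU`, `hregk_gaugeU` — the one-step letters at `(Ū^j)^{u_{j+1}}`).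
WHY (cell context).  With `B9Thm311SmallFieldCoercivityTowerTwoWindows` the k-level Thm 3.11 chain on print's diagonal displays exactly the TWO windows of
(3.35) read globally on the torus; print's (3.35) itself is a PER-CUBE GAUGE statement («there exists a gauge transformation u on □ such that …»).  This file is
the transformation law that carries the chain's conclusions along the gauge orbit — the sequel `B9Thm311TowerGaugeOrbitTwoWindows` states Thm 3.11 at `k`
levels on print's class (3.35) OF THE ONE-CUBE TORUS (□ = the torus).  NOT HERE: the per-cube localisation (IMS road B8′), decay, Green's-function covariance
`G(U^u) = R(u)G(U)R(u⁻¹)` beyond positivity transfer.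
HONEST SCOPE.  [folklore]; the class (52) and the unitarity letters of `u` (`hstar`, `hτ`, `hAd`) are hypotheses; nothing of [B9] asserted hypothesis-free;
«NE9 ⇐ the named binders»; NE9 NOT PRINTED ∕ NOT PROVED; NOT summit progress (cell pub-balaban: row NE9 WALLED ON A MODEL; spine PROVED 0/9; rung (B)+1
finite T⁴ — NOT infinite volume, NOT mass gap, NOT Clay; HONEST DEPENDENCY: continuum YM on T⁴ ⇐ BetaPertH ∧ nine spine estimates (0/9 proved); BetaPertH ⇐
(D1) ∧ (D4) ∧ CAP+tail; G-an2-4 gates asym, D1 and NE2/3/4).  NEW file; modifies nothing.  Net new unproved facts: 0.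
-/

noncomputable section

open scoped InnerProductSpace ComplexConjugate BigOperators

namespace Literature.MathematicalPhysics.QuantumFieldTheory.Balaban1983to89.B9Eq334LaplaceAkCovariance

open B4Sect5Torus (TSite)
open B9SectCLatticeCarrier (Bond bpos btgt shift)
open B7Prop1Explicit (U1 Wcx boxVec)
open B7Prop2Explicit (pdev C0 c2' AvgClosed)
open B7AvgGaugeCovariance (pdev_gaugeAct)
open B7Eq78Linearization (conjR conjR_apply)
open B9Eq311L2Pairing (WL2)
open B11Eq103H1Complex (SiteL2K BondL2K covLaplaceSiteK laplaceALatticeK)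
open B9Eq310HessianOperator (adTransportW hessOp)
open B9Eq315QTorus (perSite perCfg perCfg_apply cornerSite QtorusLin)
open B9Eq315QTorusOnto (liftSite perSite_liftSite)
open B9Eq315QTower (towerP UlevOf Qtower Qtower_zero Qtower_succ QkOfU)
open B9Eq319QprimeTorus (fineP centre)
open B9Eq326OperatorTower (QprimeTowerW QkW RofUk laplaceAk)
open B9Eq328GaugeAction (gaugeU gaugeU_apply gaugeU_inv_gaugeU AdA AdW AdW_apply_inv apply_AdW gaugeW equiv_gaugeW equiv_gaugeW_eq gaugeW_apply_inv
  gaugeW_inv_apply inner_gaugeW inner_gaugeW_left norm_gaugeW covDerivL2K_gaugeU covDivL2K_gaugeU covLaplaceSiteK_gaugeU)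
open B9Eq330HessianCovariance (hessOp_gaugeU)
open B9Eq333ProjectionCovariance (inner_AdW_inv hU1_gaugeU hreg_gaugeU QtorusLin_gaugeU AdA_eq_conjR)
open B9Eq334LaplaceACovariance (adjointQ_gaugeU)
open B5Eq172FlatFibreNaturality (map_projR_of_intertwine)
open B7Eq44TorusAxialGauge (perCfg_gaugeU')
open B9Eq332QprimeTowerGaugeCovariance (gauge_level_compat UlevOf_gaugeU QprimeTowerW_gaugeU)

variable {d : ℕ} (L : ℕ) [NeZero L] (m : Fin d → ℕ) [∀ i, NeZero (m i)] (n : ℕ)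
  {𝔸 : Type*} [NormedRing 𝔸] [NormOneClass 𝔸] [NormedAlgebra ℂ 𝔸] [CompleteSpace 𝔸] (hL : 1 ≤ L) (hL2 : 2 ≤ L) {S : Subgroup 𝔸ˣ}
  (hS : AvgClosed d L S) (U : Bond d (towerP L m (n + 1)) → 𝔸ˣ) (hU : ∀ b, U b ∈ S) (g : TSite d (towerP L m (n + 1)) → 𝔸ˣ) (hg : ∀ x, g x ∈ S)
  {α₀ : ℝ} (hα : 0 < α₀) (hα3 : C0 d * α₀ ≤ 1 / 3) (hα2 : 2 * α₀ ≤ c2' d L)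
  (h52 : pdev (perCfg (towerP L m (n + 1)) U) < α₀ * (((L : ℝ) ^ (n + 1))⁻¹) ^ 2)

/-! ## §1 «(3.32) hold again» for the composite `Q_{n+1}(U)` -/

section Qtower

variable (αU : ℕ → ℝ) (hα1 : ∀ j, αU j ≤ 1 / 64)
  (hU1 : ∀ (j : ℕ) (x : B7Prop1Explicit.Site d) (κ : Fin d), perCfg (towerP L m (j + 1)) (UlevOf L m (n + 1) U j) x κ ∈ U1 𝔸)
  (hreg : ∀ (j : ℕ) (y : TSite d (towerP L m j)) (κ : Fin d) (r : Fin d → Fin L),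
    ‖((Wcx L (perCfg (towerP L m (j + 1)) (UlevOf L m (n + 1) U j)) (cornerSite L y) κ (boxVec L r) : 𝔸ˣ) : 𝔸) - 1‖ ≤ αU j)
  (hU1' : ∀ (j : ℕ) (x : B7Prop1Explicit.Site d) (κ : Fin d), perCfg (towerP L m (j + 1)) (UlevOf L m (n + 1) (gaugeU g U) j) x κ ∈ U1 𝔸)
  (hreg' : ∀ (j : ℕ) (y : TSite d (towerP L m j)) (κ : Fin d) (r : Fin d → Fin L),
    ‖((Wcx L (perCfg (towerP L m (j + 1)) (UlevOf L m (n + 1) (gaugeU g U) j)) (cornerSite L y) κ (boxVec L r) : 𝔸ˣ) : 𝔸) - 1‖ ≤ αU j)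

/-- `QtorusLin`'s value depends on the background only (not on the regularity witnesses): equal backgrounds, any witnesses, same map.
[cite: Balaban1985BackgroundPropagators, (3.15) p.393] -/
private theorem QtorusLin_congr {P : Fin d → ℕ} [∀ i, NeZero (P i)] {V V' : Bond d (fineP L P) → 𝔸ˣ} (h : V = V') {α : ℝ} (hα1 : α ≤ 1 / 64)
    (hV1 : ∀ (x : B7Prop1Explicit.Site d) (κ : Fin d), perCfg (fineP L P) V x κ ∈ U1 𝔸)
    (hVr : ∀ (y : TSite d P) (κ : Fin d) (r : Fin d → Fin L), ‖((Wcx L (perCfg (fineP L P) V) (cornerSite L y) κ (boxVec L r) : 𝔸ˣ) : 𝔸) - 1‖ ≤ α)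
    (hV1' : ∀ (x : B7Prop1Explicit.Site d) (κ : Fin d), perCfg (fineP L P) V' x κ ∈ U1 𝔸)
    (hVr' : ∀ (y : TSite d P) (κ : Fin d) (r : Fin d → Fin L), ‖((Wcx L (perCfg (fineP L P) V') (cornerSite L y) κ (boxVec L r) : 𝔸ˣ) : 𝔸) - 1‖ ≤ α) :
    QtorusLin L P hL V hα1 hV1 hVr = QtorusLin L P hL V' hα1 hV1' hVr' := by
  subst h; rfl

include hL2 hS hU hg hα hα3 hα2 h52 in
/-- **«(3.32) HOLD AGAIN» FOR THE COMPOSITE (𝔸-valued `Qtower`)**: for `j ≤ n+1`, every `A` on the bonds of `T_{L^j m}` and every coarse bond `c`,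
`Q_j(\overline{U^u})(b ↦ R(u_j(b₋))A(b))(c) = R(u_0(c₋))·(Q_j(Ū)A)(c)`, `u_j(x) = u(L^{n+1−j}·x̃)`, `u_0(y) = u(N·ỹ)` — induction on `Qtower_succ`: the factor at
level `j` is `QtorusLin_gaugeU` at the background `\overline{U^u}^j = (Ū^j)^{u_{j+1}}` (`UlevOf_gaugeU`), and `u_{j+1}(L·y) = u_j(y)` (`gauge_level_compat`).
[cite: Balaban1985BackgroundPropagators, (3.32) p.395, p.396, (3.15) p.393; Balaban1985Averaging, (11) p.19, (43) p.24] -/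
theorem Qtower_gaugeU : ∀ j : ℕ, j ≤ n + 1 → ∀ (A : Bond d (towerP L m j) → 𝔸) (c : Bond d m),
    Qtower L m hL (UlevOf L m (n + 1) (gaugeU g U)) αU hα1 hU1' hreg' j
        (fun b => conjR (g (perSite (towerP L m (n + 1)) (((L : ℤ) ^ (n + 1 - j)) • liftSite (bpos b)))) (A b)) c =
      conjR (g (perSite (towerP L m (n + 1)) (((L : ℤ) ^ (n + 1)) • liftSite (bpos c)))) (Qtower L m hL (UlevOf L m (n + 1) U) αU hα1 hU1 hreg j A c)
  | 0, _, A, c => rfl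
  | j + 1, hj, A, c => by
    have hgU1 : ∀ x, g x ∈ U1 𝔸 := fun x => hS.le_U1 (hg x)
    -- the level gauge `u_{j+1}` on `T_{L^{j+1} m}`
    set gl : TSite d (towerP L m (j + 1)) → 𝔸ˣ := fun x => g (perSite (towerP L m (n + 1)) (((L : ℤ) ^ (n + 1 - (j + 1))) • liftSite x)) with hgl
    have hglU1 : ∀ x, gl x ∈ U1 𝔸 := fun x => hgU1 _
    -- the level background of `U^u` is the gauged level background
    have hlev : UlevOf L m (n + 1) (gaugeU g U) j = gaugeU gl (UlevOf L m (n + 1) U j) := by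
      rw [UlevOf_gaugeU L m hL2 hS (n + 1) U hU g hgU1 hα hα3 hα2 h52 j (by omega)]
      have e : n + 1 - 1 - j = n + 1 - (j + 1) := by omega
      rw [e]
    -- witnesses for the gauged level background, transported from `U`'s
    have hW1 := hU1_gaugeU L (towerP L m j) gl (UlevOf L m (n + 1) U j) hglU1 (hU1 j)
    have hWr := hreg_gaugeU L (towerP L m j) gl (UlevOf L m (n + 1) U j) hglU1 (hreg j)
    -- the factor at level `j`: (3.32) for `QtorusLin` at `(Ū^j)^{u_{j+1}}`, then the compatibility `u_{j+1}(L·y) = u_j(y)`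
    have hstep : QtorusLin L (towerP L m j) hL (UlevOf L m (n + 1) (gaugeU g U) j) (hα1 j) (hU1' j) (hreg' j)
        (fun b : Bond d (towerP L m (j + 1)) => conjR (gl (bpos b)) (A b)) =
        fun c' => conjR (g (perSite (towerP L m (n + 1)) (((L : ℤ) ^ (n + 1 - j)) • liftSite (bpos c'))))
          (QtorusLin L (towerP L m j) hL (UlevOf L m (n + 1) U j) (hα1 j) (hU1 j) (hreg j) A c') := by
      funext c'
      have hc := congrFun (LinearMap.congr_fun (QtorusLin_congr L hL hlev (hα1 j) (hU1' j) (hreg' j) hW1 hWr)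
        (fun b : Bond d (towerP L m (j + 1)) => conjR (gl (bpos b)) (A b))) c'
      have hq := QtorusLin_gaugeU L (towerP L m j) gl (UlevOf L m (n + 1) U j) hL (hα1 j) (hU1 j) (hreg j) hW1 hWr A c'
      have hcomp : gl (centre L (towerP L m j) c'.1) = g (perSite (towerP L m (n + 1)) (((L : ℤ) ^ (n + 1 - j)) • liftSite (bpos c'))) := by
        rw [hgl]; exact gauge_level_compat L m (by omega : j < n + 1) g c'.1
      rw [hc]
      exact hq.trans (by rw [hcomp])
    -- `Q_{j+1} = Q_j ∘ Q(level j)` on both sides (`Qtower_succ`, definitional), the factor by `hstep`, then the induction hypothesis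
    have e2 := congrArg (fun X : Bond d (towerP L m j) → 𝔸 => Qtower L m hL (UlevOf L m (n + 1) (gaugeU g U)) αU hα1 hU1' hreg' j X c) hstep
    exact e2.trans (Qtower_gaugeU j (by omega) _ c)

include hL2 hS hU hg hα hα3 hα2 h52 in
/-- **(3.32) for `Q_{n+1}(U)` (`QkOfU`, 𝔸-valued)**: `Q_{n+1}(U^u)(b ↦ R(u(b₋))A(b))(c) = R(u(N·c̃₋))·(Q_{n+1}(U)A)(c)`.
[cite: Balaban1985BackgroundPropagators, (3.32) p.395, p.396, (3.15) p.393] -/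
theorem QkOfU_gaugeU (A : Bond d (towerP L m (n + 1)) → 𝔸) (c : Bond d m) :
    QkOfU L m hL (n + 1) (gaugeU g U) αU hα1 hU1' hreg' (fun b => conjR (g (bpos b)) (A b)) c =
      conjR (g (perSite (towerP L m (n + 1)) (((L : ℤ) ^ (n + 1)) • liftSite (bpos c)))) (QkOfU L m hL (n + 1) U αU hα1 hU1 hreg A c) := by
  have h := Qtower_gaugeU L m n hL hL2 hS U hU g hg hα hα3 hα2 h52 αU hα1 hU1 hreg hU1' hreg' (n + 1) le_rfl A c
  simp only [Nat.sub_self, pow_zero, one_smul, perSite_liftSite] at h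
  exact h

end Qtower

/-! ## §2 (3.32) for `Q_{n+1}(U)` on the weighted `L²` carriers -/

section QkW

variable {W : Type*} [NormedAddCommGroup W] [InnerProductSpace ℂ W] (φ : W ≃ₗ[ℂ] 𝔸) {c₀ c₁ : ℝ}
  (αU : ℕ → ℝ) (hα1 : ∀ j, αU j ≤ 1 / 64)
  (hU1 : ∀ (j : ℕ) (x : B7Prop1Explicit.Site d) (κ : Fin d), perCfg (towerP L m (j + 1)) (UlevOf L m (n + 1) U j) x κ ∈ U1 𝔸)
  (hreg : ∀ (j : ℕ) (y : TSite d (towerP L m j)) (κ : Fin d) (r : Fin d → Fin L),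
    ‖((Wcx L (perCfg (towerP L m (j + 1)) (UlevOf L m (n + 1) U j)) (cornerSite L y) κ (boxVec L r) : 𝔸ˣ) : 𝔸) - 1‖ ≤ αU j)
  (hU1' : ∀ (j : ℕ) (x : B7Prop1Explicit.Site d) (κ : Fin d), perCfg (towerP L m (j + 1)) (UlevOf L m (n + 1) (gaugeU g U) j) x κ ∈ U1 𝔸)
  (hreg' : ∀ (j : ℕ) (y : TSite d (towerP L m j)) (κ : Fin d) (r : Fin d → Fin L),
    ‖((Wcx L (perCfg (towerP L m (j + 1)) (UlevOf L m (n + 1) (gaugeU g U) j)) (cornerSite L y) κ (boxVec L r) : 𝔸ˣ) : 𝔸) - 1‖ ≤ αU j)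

/-- Unfolding `QkW` on the representatives (as `B9Eq315QTorus.QtorusW_apply`). [cite: Balaban1985BackgroundPropagators, (3.15)–(3.16) p.393] -/
theorem QkW_apply (V : Bond d (towerP L m (n + 1)) → 𝔸ˣ)
    (hV1 : ∀ (j : ℕ) (x : B7Prop1Explicit.Site d) (κ : Fin d), perCfg (towerP L m (j + 1)) (UlevOf L m (n + 1) V j) x κ ∈ U1 𝔸)
    (hVr : ∀ (j : ℕ) (y : TSite d (towerP L m j)) (κ : Fin d) (r : Fin d → Fin L),
      ‖((Wcx L (perCfg (towerP L m (j + 1)) (UlevOf L m (n + 1) V j)) (cornerSite L y) κ (boxVec L r) : 𝔸ˣ) : 𝔸) - 1‖ ≤ αU j)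
    (f : BondL2K ℂ d (towerP L m (n + 1)) c₀ W) (c : Bond d m) :
    WL2.equiv ℂ _ W (QkW L m n φ V hL αU hα1 hV1 hVr (c₁ := c₁) f) c =
      φ.symm (QkOfU L m hL (n + 1) V αU hα1 hV1 hVr (fun b => φ (WL2.equiv ℂ _ W f b)) c) := rfl

include hL2 hS hU hg hα hα3 hα2 h52 in
/-- **«(3.32) HOLD AGAIN» FOR THE CHAIN's `Q_{n+1}(U)` ON THE WEIGHTED `L²` SPACES**: `Q_{n+1}(U^u)(R(u)f) = R(u_0)(Q_{n+1}(U)f)`, `u_0(c₋) = u(N·c̃₋)` the gauge at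
the unit block's origin — whatever regularity witnesses are supplied on the two sides. [cite: Balaban1985BackgroundPropagators, (3.32) p.395, p.396, (3.15) p.393; Balaban1985Averaging, (11) p.19] -/
theorem QkW_gaugeU (f : BondL2K ℂ d (towerP L m (n + 1)) c₀ W) :
    QkW L m n φ (gaugeU g U) hL αU hα1 hU1' hreg' (c₁ := c₁) (gaugeW φ (fun b : Bond d (towerP L m (n + 1)) => g (bpos b)) f) =
      gaugeW φ (fun c : Bond d m => g (perSite (towerP L m (n + 1)) (((L : ℤ) ^ (n + 1)) • liftSite (bpos c))))
        (QkW L m n φ U hL αU hα1 hU1 hreg (c₁ := c₁) f) := by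
  apply (WL2.equiv ℂ (fun _ : Bond d m => c₁) W).injective
  funext c
  rw [QkW_apply, equiv_gaugeW, QkW_apply, B9Eq328GaugeAction.AdW_apply, LinearEquiv.apply_symm_apply, ← conjR_apply]
  simp only [equiv_gaugeW, apply_AdW, AdA_eq_conjR]
  rw [QkOfU_gaugeU L m n hL hL2 hS U hU g hg hα hα3 hα2 h52 αU hα1 hU1 hreg hU1' hreg']

end QkW

/-! ## §3 (3.33b) one storey up: `R_k(U^u)R(u) = R(u)R_k(U)` -/

section Projection

variable {W : Type*} [NormedAddCommGroup W] [InnerProductSpace ℂ W] (φ : W ≃ₗ[ℂ] 𝔸) {c₀ : ℝ} (η : ℝ)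

include hL2 hS hU hg hα hα3 hα2 h52 in
/-- **(3.32) for the kernels**: `Q′_{n+1}(U^u)(R(u)λ) = 0 ↔ Q′_{n+1}(U)λ = 0`. [cite: Balaban1985BackgroundPropagators, (3.32) p.395, (3.22) p.394] -/
theorem QprimeTowerW_gaugeU_eq_zero_iff (lam : SiteL2K ℂ d (towerP L m (n + 1)) c₀ W) :
    QprimeTowerW L m n φ (gaugeU g U) (c₀ := c₀) (gaugeW φ g lam) = 0 ↔ QprimeTowerW L m n φ U (c₀ := c₀) lam = 0 := by
  have hgU1 : ∀ x, g x ∈ U1 𝔸 := fun x => hS.le_U1 (hg x)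
  have key : ∀ y, QprimeTowerW L m n φ (gaugeU g U) (c₀ := c₀) (gaugeW φ g lam) y =
      AdW φ (g (perSite (towerP L m (n + 1)) (((L : ℤ) ^ (n + 1)) • liftSite y))) (QprimeTowerW L m n φ U (c₀ := c₀) lam y) :=
    fun y => QprimeTowerW_gaugeU L m hL2 hS n U hU g hgU1 hα hα3 hα2 h52 φ lam y
  constructor
  · intro h
    funext y
    have hy := congrFun h y
    rw [key y, Pi.zero_apply] at hy
    have : QprimeTowerW L m n φ U (c₀ := c₀) lam y =
        AdW φ (g (perSite (towerP L m (n + 1)) (((L : ℤ) ^ (n + 1)) • liftSite y)))⁻¹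
          (AdW φ (g (perSite (towerP L m (n + 1)) (((L : ℤ) ^ (n + 1)) • liftSite y))) (QprimeTowerW L m n φ U (c₀ := c₀) lam y)) := by
      rw [← B9Eq328GaugeAction.AdW_mul_apply, inv_mul_cancel, B9Eq328GaugeAction.AdW_apply]
      simp
    rw [this, hy, map_zero, Pi.zero_apply]
  · intro h
    funext y
    rw [key y, h, Pi.zero_apply, map_zero]

variable [FiniteDimensional ℂ W] [Fact (0 < c₀)]

include hL2 hS hU hg hα hα3 hα2 h52 in
/-- **(3.33b) ONE STOREY UP: `R_k(U^u) R(u) = R(u) R_k(U)`** for the chain's `RofUk` = the orthogonal projection onto `Δ^η_U N(Q′_{n+1}(U))`: `R(u)` is unitary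
on the gauge parameters (`hAd`), intertwines `Δ^η_U ∕ Δ^η_{U^u}` ((3.31)) and the kernels `N(Q′_{n+1}(U)) ∕ N(Q′_{n+1}(U^u))` ((3.32) for the composite),
hence the two projections (`map_projR_of_intertwine`) — the one-step `RofU_gaugeU` verbatim on the tower objects.
[cite: Balaban1985BackgroundPropagators, (3.33) p.396, (3.21)–(3.23) p.394] -/
theorem RofUk_gaugeU (hAd : ∀ (x : TSite d (towerP L m (n + 1))) (v v' : W), ⟪AdW φ (g x) v, AdW φ (g x) v'⟫_ℂ = ⟪v, v'⟫_ℂ)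
    (v : SiteL2K ℂ d (towerP L m (n + 1)) c₀ W) :
    RofUk L m n φ η (gaugeU g U) (gaugeW φ g v) = gaugeW φ g (RofUk L m n φ η U v) := by
  have hgU1 : ∀ x, g x ∈ U1 𝔸 := fun x => hS.le_U1 (hg x)
  -- the gauged background is in the same class, and `u⁻¹` is an `S`-valued gauge
  have hU' : ∀ b, gaugeU g U b ∈ S := fun b => by
    rw [gaugeU_apply]; exact S.mul_mem (S.mul_mem (hg _) (hU _)) (S.inv_mem (hg _))
  have hg' : ∀ x, g⁻¹ x ∈ S := fun x => by rw [Pi.inv_apply]; exact S.inv_mem (hg _)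
  have h52' : pdev (perCfg (towerP L m (n + 1)) (gaugeU g U)) < α₀ * (((L : ℝ) ^ (n + 1))⁻¹) ^ 2 := by
    rw [perCfg_gaugeU', pdev_gaugeAct (fun z => hgU1 _)]; exact h52
  have hΔ' : ∀ f : SiteL2K ℂ d (towerP L m (n + 1)) c₀ W,
      gaugeW φ g (covLaplaceSiteK ((η : ℂ))⁻¹ (adTransportW φ U) (adTransportW φ fun b => (U b)⁻¹) f) =
        covLaplaceSiteK ((η : ℂ))⁻¹ (adTransportW φ (gaugeU g U)) (adTransportW φ fun b => (gaugeU g U b)⁻¹) (gaugeW φ g f) :=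
    fun f => (covLaplaceSiteK_gaugeU φ _ g U f).symm
  have hΔ : ∀ a : SiteL2K ℂ d (towerP L m (n + 1)) c₀ W,
      gaugeW φ g⁻¹ (covLaplaceSiteK ((η : ℂ))⁻¹ (adTransportW φ (gaugeU g U)) (adTransportW φ fun b => (gaugeU g U b)⁻¹) a) =
        covLaplaceSiteK ((η : ℂ))⁻¹ (adTransportW φ U) (adTransportW φ fun b => (U b)⁻¹) (gaugeW φ g⁻¹ a) := by
    intro a
    have h := hΔ' (gaugeW φ g⁻¹ a)
    rw [gaugeW_apply_inv] at h
    rw [← h, gaugeW_inv_apply]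
  have hQ' : ∀ f : SiteL2K ℂ d (towerP L m (n + 1)) c₀ W,
      QprimeTowerW L m n φ U f = 0 → QprimeTowerW L m n φ (gaugeU g U) (gaugeW φ g f) = 0 :=
    fun f hf => (QprimeTowerW_gaugeU_eq_zero_iff L m n hL2 hS U hU g hg hα hα3 hα2 h52 φ f).2 hf
  have hQ : ∀ a : SiteL2K ℂ d (towerP L m (n + 1)) c₀ W,
      QprimeTowerW L m n φ (gaugeU g U) a = 0 → QprimeTowerW L m n φ U (gaugeW φ g⁻¹ a) = 0 := by
    intro a ha
    have h := (QprimeTowerW_gaugeU_eq_zero_iff L m n hL2 hS (gaugeU g U) hU' g⁻¹ hg' hα hα3 hα2 h52' φ a).2 ha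
    rwa [gaugeU_inv_gaugeU] at h
  have hadj : ∀ (a f : SiteL2K ℂ d (towerP L m (n + 1)) c₀ W), ⟪a, gaugeW φ g f⟫_ℂ = ⟪gaugeW φ g⁻¹ a, f⟫_ℂ := by
    intro a f
    rw [inner_gaugeW_left φ g⁻¹ (inner_AdW_inv L (towerP L m n) φ hAd), inv_inv]
  have key := map_projR_of_intertwine
    (covLaplaceSiteK (c₀ := c₀) ((η : ℂ))⁻¹ (adTransportW φ (gaugeU g U)) (adTransportW φ fun b => (gaugeU g U b)⁻¹))
    (QprimeTowerW L m n φ (gaugeU g U) (c₀ := c₀))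
    (covLaplaceSiteK (c₀ := c₀) ((η : ℂ))⁻¹ (adTransportW φ U) (adTransportW φ fun b => (U b)⁻¹)) (QprimeTowerW L m n φ U (c₀ := c₀))
    (gaugeW φ g⁻¹) (gaugeW φ g) hadj hΔ hΔ' hQ hQ' v
  exact key.symm

include hL2 hS hU hg hα hα3 hα2 h52 in
/-- (3.33b) one storey up in the printed shape `R_k(U^u) = R(u)R_k(U)R(u⁻¹)`. [cite: Balaban1985BackgroundPropagators, (3.33) p.396] -/
theorem RofUk_gaugeU_conj (hAd : ∀ (x : TSite d (towerP L m (n + 1))) (v v' : W), ⟪AdW φ (g x) v, AdW φ (g x) v'⟫_ℂ = ⟪v, v'⟫_ℂ) :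
    RofUk L m n φ η (gaugeU g U) (c₀ := c₀) = gaugeW φ g ∘ₗ RofUk L m n φ η U ∘ₗ gaugeW φ g⁻¹ := by
  apply LinearMap.ext
  intro v
  rw [LinearMap.comp_apply, LinearMap.comp_apply, ← RofUk_gaugeU L m n hL2 hS U hU g hg hα hα3 hα2 h52 φ η hAd, gaugeW_apply_inv]

end Projection

/-! ## §4 (3.34a) one storey up: `Δ^{(k)}_a(U^u) R(u) = R(u) Δ^{(k)}_a(U)` -/

section LaplaceAk

variable [StarRing 𝔸] [StarModule ℂ 𝔸] {W : Type*} [NormedAddCommGroup W] [InnerProductSpace ℂ W] [FiniteDimensional ℂ W] (φ : W ≃ₗ[ℂ] 𝔸)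
  {c₀ c₁ : ℝ} [Fact (0 < c₀)] [Fact (0 < c₁)] (τ : 𝔸 →ₗ[ℂ] ℂ) (η : ℝ)
  (αU : ℕ → ℝ) (hα1 : ∀ j, αU j ≤ 1 / 64)
  (hU1 : ∀ (j : ℕ) (x : B7Prop1Explicit.Site d) (κ : Fin d), perCfg (towerP L m (j + 1)) (UlevOf L m (n + 1) U j) x κ ∈ U1 𝔸)
  (hreg : ∀ (j : ℕ) (y : TSite d (towerP L m j)) (κ : Fin d) (r : Fin d → Fin L),
    ‖((Wcx L (perCfg (towerP L m (j + 1)) (UlevOf L m (n + 1) U j)) (cornerSite L y) κ (boxVec L r) : 𝔸ˣ) : 𝔸) - 1‖ ≤ αU j)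
  (hU1' : ∀ (j : ℕ) (x : B7Prop1Explicit.Site d) (κ : Fin d), perCfg (towerP L m (j + 1)) (UlevOf L m (n + 1) (gaugeU g U) j) x κ ∈ U1 𝔸)
  (hreg' : ∀ (j : ℕ) (y : TSite d (towerP L m j)) (κ : Fin d) (r : Fin d → Fin L),
    ‖((Wcx L (perCfg (towerP L m (j + 1)) (UlevOf L m (n + 1) (gaugeU g U) j)) (cornerSite L y) κ (boxVec L r) : 𝔸ˣ) : 𝔸) - 1‖ ≤ αU j)
  (hτ : ∀ (x : TSite d (towerP L m (n + 1))) (X : 𝔸), τ (AdA (g x) X) = τ X) (hstar : ∀ x, star (g x : 𝔸) = ((g x)⁻¹ : 𝔸ˣ))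
  (hAd : ∀ (x : TSite d (towerP L m (n + 1))) (v v' : W), ⟪AdW φ (g x) v, AdW φ (g x) v'⟫_ℂ = ⟪v, v'⟫_ℂ)

include hL2 hS hU hg hα hα3 hα2 h52 hτ hstar hAd in
/-- **(3.34a) ONE STOREY UP: `Δ^{(n+1)}_a(U^u)(R(u)f) = R(u)(Δ^{(n+1)}_a(U)f)`** for the chain's `laplaceAk` (Hessian (3.10) + `D R_k(U) D*` + `Q_k* a Q_k`)
— from (3.30) `hessOp_gaugeU`, (3.3)∕(3.8) `covDerivL2K_gaugeU` ∕ `covDivL2K_gaugeU`, §3 `RofUk_gaugeU`, §2 `QkW_gaugeU` and the adjoint slot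
(`adjointQ_gaugeU`), whatever regularity witnesses are supplied for `U` and `U^u`. [cite: Balaban1985BackgroundPropagators, (3.34) p.396, (3.26) p.395] -/
theorem laplaceAk_gaugeU (a : ℝ) (f : BondL2K ℂ d (towerP L m (n + 1)) c₀ W) :
    laplaceAk L m n φ η (gaugeU g U) hL αU hα1 hU1' hreg' τ (c₀ := c₀) (c₁ := c₁) a
        (gaugeW φ (fun b : Bond d (towerP L m (n + 1)) => g (bpos b)) f) =
      gaugeW φ (fun b : Bond d (towerP L m (n + 1)) => g (bpos b)) (laplaceAk L m n φ η U hL αU hα1 hU1 hreg τ (c₀ := c₀) (c₁ := c₁) a f) := by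
  set Q := QkW L m n φ U hL αU hα1 hU1 hreg (c₀ := c₀) (c₁ := c₁) with hQdef
  set Q' := QkW L m n φ (gaugeU g U) hL αU hα1 hU1' hreg' (c₀ := c₀) (c₁ := c₁) with hQ'def
  set TF := gaugeW φ (fun c : Bond d m => g (perSite (towerP L m (n + 1)) (((L : ℤ) ^ (n + 1)) • liftSite (bpos c)))) (w := fun _ : Bond d m => c₁)
    with hTFdef
  have hTF : ∀ h h' : BondL2K ℂ d m c₁ W, ⟪TF h, TF h'⟫_ℂ = ⟪h, h'⟫_ℂ :=
    inner_gaugeW φ (w := fun _ : Bond d m => c₁) _ fun c => hAd _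
  have hQ : ∀ f, Q' (gaugeW φ (fun b : Bond d (towerP L m (n + 1)) => g (bpos b)) f) = TF (Q f) :=
    fun f => QkW_gaugeU L m n hL hL2 hS U hU g hg hα hα3 hα2 h52 φ αU hα1 hU1 hreg hU1' hreg' f
  have hQs : ∀ s : ℂ, LinearMap.adjoint Q' (s • Q' (gaugeW φ (fun b : Bond d (towerP L m (n + 1)) => g (bpos b)) f)) =
      gaugeW φ (fun b : Bond d (towerP L m (n + 1)) => g (bpos b)) (LinearMap.adjoint Q (s • Q f)) := fun s => by
    rw [hQ, ← map_smul]
    exact adjointQ_gaugeU L (towerP L m n) φ Q Q' TF hAd hTF hQ (s • Q f)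
  rw [laplaceAk, laplaceAk, laplaceALatticeK, laplaceALatticeK, B11Eq103H1Complex.laplaceAK_apply, B11Eq103H1Complex.laplaceAK_apply,
    hessOp_gaugeU U φ τ η hτ hstar hAd, covDivL2K_gaugeU, RofUk_gaugeU L m n hL2 hS U hU g hg hα hα3 hα2 h52 φ η hAd, covDerivL2K_gaugeU,
    ← hQ'def, ← hQdef, hQs, map_add, map_add]

include hL2 hS hU hg hα hα3 hα2 h52 hτ hstar hAd in
/-- **(3.34a) in the printed shape `Δ^{(n+1)}_a(U^u) = R(u)Δ^{(n+1)}_a(U)R(u⁻¹)`** as an equality of linear maps. [cite: Balaban1985BackgroundPropagators, (3.34) p.396] -/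
theorem laplaceAk_gaugeU_conj (a : ℝ) :
    laplaceAk L m n φ η (gaugeU g U) hL αU hα1 hU1' hreg' τ (c₀ := c₀) (c₁ := c₁) a =
      gaugeW φ (fun b : Bond d (towerP L m (n + 1)) => g (bpos b)) ∘ₗ laplaceAk L m n φ η U hL αU hα1 hU1 hreg τ (c₀ := c₀) (c₁ := c₁) a ∘ₗ
        gaugeW φ (fun b : Bond d (towerP L m (n + 1)) => g (bpos b))⁻¹ := by
  apply LinearMap.ext
  intro f
  rw [LinearMap.comp_apply, LinearMap.comp_apply,
    ← laplaceAk_gaugeU L m n hL hL2 hS U hU g hg hα hα3 hα2 h52 φ τ η αU hα1 hU1 hreg hU1' hreg' hτ hstar hAd, gaugeW_apply_inv]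

include hL2 hS hU hg hα hα3 hα2 h52 hτ hstar hAd in
/-- **THE QUADRATIC FORM OF `Δ^{(n+1)}_a` IS GAUGE INVARIANT: `⟨R(u)f, Δ^{(n+1)}_a(U^u)R(u)f⟩ = ⟨f, Δ^{(n+1)}_a(U)f⟩`.**
[cite: Balaban1985BackgroundPropagators, (3.34) p.396] -/
theorem inner_laplaceAk_gaugeU (a : ℝ) (f : BondL2K ℂ d (towerP L m (n + 1)) c₀ W) :
    ⟪gaugeW φ (fun b : Bond d (towerP L m (n + 1)) => g (bpos b)) f,
        laplaceAk L m n φ η (gaugeU g U) hL αU hα1 hU1' hreg' τ (c₀ := c₀) (c₁ := c₁) a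
          (gaugeW φ (fun b : Bond d (towerP L m (n + 1)) => g (bpos b)) f)⟫_ℂ =
      ⟪f, laplaceAk L m n φ η U hL αU hα1 hU1 hreg τ (c₀ := c₀) (c₁ := c₁) a f⟫_ℂ := by
  rw [laplaceAk_gaugeU L m n hL hL2 hS U hU g hg hα hα3 hα2 h52 φ τ η αU hα1 hU1 hreg hU1' hreg' hτ hstar hAd,
    inner_gaugeW φ (w := fun _ : Bond d (towerP L m (n + 1)) => c₀) _ fun b => hAd (bpos b)]

include hL2 hS hU hg hα hα3 hα2 h52 hτ hstar hAd in
/-- **POSITIVE DEFINITENESS TRANSFERS BOTH WAYS ALONG THE ORBIT** (Thm 3.11 «Δ_a is positive definite» is a statement about the class (3.35)).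
[cite: Balaban1985BackgroundPropagators, Thm 3.11 p.416, (3.34) p.396] -/
theorem hposk_gaugeU_iff (a : ℝ) :
    (∀ x : BondL2K ℂ d (towerP L m (n + 1)) c₀ W, x ≠ 0 →
        0 < RCLike.re ⟪x, laplaceAk L m n φ η (gaugeU g U) hL αU hα1 hU1' hreg' τ (c₀ := c₀) (c₁ := c₁) a x⟫_ℂ) ↔
      (∀ x : BondL2K ℂ d (towerP L m (n + 1)) c₀ W, x ≠ 0 →
        0 < RCLike.re ⟪x, laplaceAk L m n φ η U hL αU hα1 hU1 hreg τ (c₀ := c₀) (c₁ := c₁) a x⟫_ℂ) := by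
  have hg0 : ∀ x : BondL2K ℂ d (towerP L m (n + 1)) c₀ W,
      gaugeW φ (fun b : Bond d (towerP L m (n + 1)) => g (bpos b)) x = 0 ↔ x = 0 :=
    fun x => B9Eq328GaugeAction.gaugeW_eq_zero_iff φ _ x
  constructor
  · intro h x hx
    have h1 := h (gaugeW φ (fun b : Bond d (towerP L m (n + 1)) => g (bpos b)) x) (fun h0 => hx ((hg0 x).1 h0))
    rwa [inner_laplaceAk_gaugeU L m n hL hL2 hS U hU g hg hα hα3 hα2 h52 φ τ η αU hα1 hU1 hreg hU1' hreg' hτ hstar hAd] at h1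
  · intro h x hx
    obtain ⟨y, rfl⟩ : ∃ y, gaugeW φ (fun b : Bond d (towerP L m (n + 1)) => g (bpos b)) y = x := ⟨_, gaugeW_apply_inv φ _ x⟩
    have hy : y ≠ 0 := fun hy => hx (by rw [hy, map_zero])
    rw [inner_laplaceAk_gaugeU L m n hL hL2 hS U hU g hg hα hα3 hα2 h52 φ τ η αU hα1 hU1 hreg hU1' hreg' hτ hstar hAd]
    exact h y hy

end LaplaceAk

/-! ## §5 E162's per-level data transfer along the orbit (levels `j ≤ n`) -/

section Data

include hL2 hS hU hg hα hα3 hα2 h52 in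
/-- E162's unit-boundedness letter at level `j ≤ n` transfers to `U^u`: `\overline{U^u}^j = (Ū^j)^{u_{j+1}}` and the one-step `hU1_gaugeU`.
[cite: Balaban1985Averaging, (11) p.19, (43) p.24; Balaban1985BackgroundPropagators, (3.15) p.393, (3.28) p.395] -/
theorem hU1k_gaugeU {j : ℕ} (hj : j ≤ n)
    (hU1 : ∀ (x : B7Prop1Explicit.Site d) (κ : Fin d), perCfg (towerP L m (j + 1)) (UlevOf L m (n + 1) U j) x κ ∈ U1 𝔸)
    (x : B7Prop1Explicit.Site d) (κ : Fin d) : perCfg (towerP L m (j + 1)) (UlevOf L m (n + 1) (gaugeU g U) j) x κ ∈ U1 𝔸 := by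
  have hgU1 : ∀ x, g x ∈ U1 𝔸 := fun x => hS.le_U1 (hg x)
  rw [UlevOf_gaugeU L m hL2 hS (n + 1) U hU g hgU1 hα hα3 hα2 h52 j (by omega)]
  exact hU1_gaugeU L (towerP L m j) _ (UlevOf L m (n + 1) U j) (fun _ => hgU1 _) hU1 x κ

include hL2 hS hU hg hα hα3 hα2 h52 in
/-- E162's block-contour regularity letter at level `j ≤ n` transfers to `U^u` with the same `α_j` (the one-step `hreg_gaugeU`: a closed holonomy conjugated by
`u` at the block corner has the same distance to `1`). [cite: Balaban1985Averaging, (42) p.23, (45) p.24; Balaban1985BackgroundPropagators, (3.15) p.393, (3.28) p.395] -/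
theorem hregk_gaugeU {j : ℕ} (hj : j ≤ n) {αj : ℝ}
    (hreg : ∀ (y : TSite d (towerP L m j)) (κ : Fin d) (r : Fin d → Fin L),
      ‖((Wcx L (perCfg (towerP L m (j + 1)) (UlevOf L m (n + 1) U j)) (cornerSite L y) κ (boxVec L r) : 𝔸ˣ) : 𝔸) - 1‖ ≤ αj)
    (y : TSite d (towerP L m j)) (κ : Fin d) (r : Fin d → Fin L) :
    ‖((Wcx L (perCfg (towerP L m (j + 1)) (UlevOf L m (n + 1) (gaugeU g U) j)) (cornerSite L y) κ (boxVec L r) : 𝔸ˣ) : 𝔸) - 1‖ ≤ αj := by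
  have hgU1 : ∀ x, g x ∈ U1 𝔸 := fun x => hS.le_U1 (hg x)
  rw [UlevOf_gaugeU L m hL2 hS (n + 1) U hU g hgU1 hα hα3 hα2 h52 j (by omega)]
  exact hreg_gaugeU L (towerP L m j) _ (UlevOf L m (n + 1) U j) (fun _ => hgU1 _) hreg y κ r

end Data

end Literature.MathematicalPhysics.QuantumFieldTheory.Balaban1983to89.B9Eq334LaplaceAkCovariance

end
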